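import Summits.Ventures.WeilGRH.TwistedOddParityFar
import Summits.Ventures.WeilGRH.TwistedDataRung
import HarnessLib

/-!
# GRH arm (rh-explicit, venture WeilGRH): twisted format C with the PARITY-1 kernel — the data door for an ODD real
  character, modulo the `sech` column tail

Cell `rh-explicit`, WEIL TRACK — GRH ARM (lit/typing seat weil-grh-5 gen11; weil-grh-2 gen7's ASK, INBOX 2026-08-23T09:30Z).
The parity-1 twin of `weilPositivityOnChar_of_twisted_formatC_data` (`TwistedDataRung.lean`) for weil-grh-1's kernel
`twistedGramCoeffOdd χ a = twistedGramCoeff χ a + π δ − sechIncrCoeff a` (the kernel that KEEPS the parity bonus; by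
weil-grh-2 gen7's twin the parity-0 kernel certifies no odd cell of the finite remainder, the parity-1 kernel all of them at
order 1).  Typed here: far coercivity with the parity-0 diagonals (`TwistedOddParityFar.lean`: the bonus block is PSD),
exact columns on `[B, B₃)` (weil-10's `columns_majorant`), the numeric sign facts, weil-10's split ∀N soundness and
weil-grh-1's `weilPositivityOnChar_of_twistedGramCoeffOdd_sector_psd`:

* `weilPositivityOnChar_of_twistedOdd_formatC_data` — `q ≠ 1`, `conj χ = χ`, `a_χ = 1`, `a > 0`; EVEN sector: block
  `B⁺ ≥ 2`, columns `B⁺ ≤ B₃⁺` with weights `0 < w⁺_m ≤ d̂⁺_χ(m)`, sign facts `0 < d̂⁺_χ(B⁺)`, `0 < d₀⁺ ≤ d̂⁺_χ(B₃⁺)`, a TAIL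
  MAJORANT `U₂⁺` with its inequality `hU2e` (`∀ N x, Σ_{m∈Ico B₃⁺ N}(Σ_i M⁺(i,m)x_i)²/d̂⁺_χ(m) ≤ xᵀU₂⁺x` — the one analytic
  input NOT typed here: it needs the `O(1/m²)` decay of the `sech` sector columns, one integration by parts), and the kernel
  certificate `hSe`; ODD sector likewise (`B⁻ ≥ 1`, `d̂⁻_χ` arctan form, `U₂⁻`, `hU2o`, `hSo`) ⟹ `WeilPositivityOnChar χ a`.

No definitions; no named facts; RH/GRH-free; standard axioms.
-/

set_option autoImplicit false

noncomputable section

open Complex Finset Matrix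
open scoped Real BigOperators ComplexConjugate ArithmeticFunction.vonMangoldt

namespace Summit.Ventures.WeilGRH

open Literature.NumberTheory.LFunctions
open Literature.NumberTheory.LFunctions.Yoshida1992 (freq incrCoeff archCoeff archExpSumSin)
open Literature.Analysis.SpecialFunctions
open Summit.RiemannHypothesis.RiemannHypothesis.Theorems.WeilFormatC

variable {q : ℕ} {a : ℝ}

section Rung

/-- **Twisted format C with the parity-1 kernel, data door modulo the tail majorants.**  See the module docstring. -/
theorem weilPositivityOnChar_of_twistedOdd_formatC_data (hq : q ≠ 1) (χ : DirichletCharacter ℂ q)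
    (hχ : ∀ n : ℕ, conj (χ (n : ZMod q)) = χ (n : ZMod q)) (hodd : charParity χ = 1) (ha : 0 < a)
    -- EVEN sector data
    {Be B3e : ℕ} (hBe : 2 ≤ Be) (hBBe : Be ≤ B3e) (we : ℕ → ℝ) (U2e : Matrix (Fin Be) (Fin Be) ℝ)
    (h0e : 0 < ((reDigammaQuarter (freq a Be) - Real.log π + Real.log q) / 2 - a * (1 + weilArchDensity (2 * a)) / (π ^ 2 * Be ^ 2) - 1 / (8 * Be) - a * (1 + weilArchDensity (2 * a)) / π ^ 2 * Real.sqrt (8 / ((Be - 1 : ℕ) : ℝ)) - (∑ k ∈ weilPrimeIndex a, (Λ k : ℝ) / Real.sqrt k * (2 * Real.cos (π / (⌊2 * a / Real.log k⌋₊ + 2)))) / 2))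
    (hwe : ∀ m, Be ≤ m → m < B3e → 0 < we m ∧ we m ≤ ((reDigammaQuarter (freq a m) - Real.log π + Real.log q) / 2 - a * (1 + weilArchDensity (2 * a)) / (π ^ 2 * m ^ 2) - 1 / (8 * m) - a * (1 + weilArchDensity (2 * a)) / π ^ 2 * Real.sqrt (8 / ((Be - 1 : ℕ) : ℝ)) - (∑ k ∈ weilPrimeIndex a, (Λ k : ℝ) / Real.sqrt k * (2 * Real.cos (π / (⌊2 * a / Real.log k⌋₊ + 2)))) / 2))
    (hU2e : ∀ (N : ℕ) (x : Fin Be → ℝ),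
      ∑ m ∈ Finset.Ico B3e N, (∑ i : Fin Be, (if (i : ℕ) = 0 then twistedGramCoeffOdd χ a 0 m else if m = 0 then twistedGramCoeffOdd χ a i 0 else (twistedGramCoeffOdd χ a i m + twistedGramCoeffOdd χ a i (-(m : ℤ))) / 2) * x i) ^ 2 / ((reDigammaQuarter (freq a m) - Real.log π + Real.log q) / 2 - a * (1 + weilArchDensity (2 * a)) / (π ^ 2 * m ^ 2) - 1 / (8 * m) - a * (1 + weilArchDensity (2 * a)) / π ^ 2 * Real.sqrt (8 / ((Be - 1 : ℕ) : ℝ)) - (∑ k ∈ weilPrimeIndex a, (Λ k : ℝ) / Real.sqrt k * (2 * Real.cos (π / (⌊2 * a / Real.log k⌋₊ + 2)))) / 2)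
        ≤ x ⬝ᵥ U2e *ᵥ x)
    (hSe : ∀ x : Fin Be → ℝ, 0 ≤ ∑ i, ∑ j, x i * x j *
      ((if (i : ℕ) = 0 then twistedGramCoeffOdd χ a 0 j else if (j : ℕ) = 0 then twistedGramCoeffOdd χ a i 0 else (twistedGramCoeffOdd χ a i j + twistedGramCoeffOdd χ a i (-(j : ℤ))) / 2)
        - (∑ m ∈ Finset.Ico Be B3e, (if (i : ℕ) = 0 then twistedGramCoeffOdd χ a 0 m else if m = 0 then twistedGramCoeffOdd χ a i 0 else (twistedGramCoeffOdd χ a i m + twistedGramCoeffOdd χ a i (-(m : ℤ))) / 2) * (if (j : ℕ) = 0 then twistedGramCoeffOdd χ a 0 m else if m = 0 then twistedGramCoeffOdd χ a j 0 else (twistedGramCoeffOdd χ a j m + twistedGramCoeffOdd χ a j (-(m : ℤ))) / 2) / we m)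
        - U2e i j))
    -- ODD sector data
    {Bo B3o : ℕ} (hBo : 1 ≤ Bo) (hBBo : Bo ≤ B3o) (wo : ℕ → ℝ) (U2o : Matrix (Fin Bo) (Fin Bo) ℝ)
    (h0o : 0 < ((reDigammaQuarter (freq a ((Bo : ℤ) + 1)) - Real.log π + Real.log q) / 2 - 1 / (8 * ((Bo : ℝ) + 1)) - a * (1 + weilArchDensity (2 * a)) / (π ^ 2 * ((Bo : ℝ) + 1) ^ 2)) - π / 4 - a * (1 + weilArchDensity (2 * a)) / π ^ 2 * Real.sqrt (8 / Bo) - (∑ k ∈ weilPrimeIndex a, (Λ k : ℝ) / Real.sqrt k * (2 * Real.cos (π / (⌊2 * a / Real.log k⌋₊ + 2)))) / 2)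
    (hwo : ∀ l, Bo ≤ l → l < B3o → 0 < wo l ∧ wo l ≤ ((reDigammaQuarter (freq a ((l : ℤ) + 1)) - Real.log π + Real.log q) / 2 - 1 / (8 * ((l : ℝ) + 1)) - a * (1 + weilArchDensity (2 * a)) / (π ^ 2 * ((l : ℝ) + 1) ^ 2) - (π / 2 - Real.arctan (Real.sqrt Bo / Real.sqrt ((l : ℝ) + 1))) / 2 - a * (1 + weilArchDensity (2 * a)) / π ^ 2 * Real.sqrt (8 / Bo) - (∑ k ∈ weilPrimeIndex a, (Λ k : ℝ) / Real.sqrt k * (2 * Real.cos (π / (⌊2 * a / Real.log k⌋₊ + 2)))) / 2))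
    (hU2o : ∀ (N : ℕ) (x : Fin Bo → ℝ),
      ∑ l ∈ Finset.Ico B3o N, (∑ k : Fin Bo, ((twistedGramCoeffOdd χ a (((k : ℕ) : ℤ) + 1) ((l : ℤ) + 1) - twistedGramCoeffOdd χ a (((k : ℕ) : ℤ) + 1) (-((l : ℤ) + 1))) / 2) * x k) ^ 2 / ((reDigammaQuarter (freq a ((l : ℤ) + 1)) - Real.log π + Real.log q) / 2 - 1 / (8 * ((l : ℝ) + 1)) - a * (1 + weilArchDensity (2 * a)) / (π ^ 2 * ((l : ℝ) + 1) ^ 2) - (π / 2 - Real.arctan (Real.sqrt Bo / Real.sqrt ((l : ℝ) + 1))) / 2 - a * (1 + weilArchDensity (2 * a)) / π ^ 2 * Real.sqrt (8 / Bo) - (∑ k ∈ weilPrimeIndex a, (Λ k : ℝ) / Real.sqrt k * (2 * Real.cos (π / (⌊2 * a / Real.log k⌋₊ + 2)))) / 2)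
        ≤ x ⬝ᵥ U2o *ᵥ x)
    (hSo : ∀ x : Fin Bo → ℝ, 0 ≤ ∑ k, ∑ k', x k * x k' *
      (((twistedGramCoeffOdd χ a (((k : ℕ) : ℤ) + 1) (((k' : ℕ) : ℤ) + 1) - twistedGramCoeffOdd χ a (((k : ℕ) : ℤ) + 1) (-(((k' : ℕ) : ℤ) + 1))) / 2)
        - (∑ l ∈ Finset.Ico Bo B3o, ((twistedGramCoeffOdd χ a (((k : ℕ) : ℤ) + 1) ((l : ℤ) + 1) - twistedGramCoeffOdd χ a (((k : ℕ) : ℤ) + 1) (-((l : ℤ) + 1))) / 2) * ((twistedGramCoeffOdd χ a (((k' : ℕ) : ℤ) + 1) ((l : ℤ) + 1) - twistedGramCoeffOdd χ a (((k' : ℕ) : ℤ) + 1) (-((l : ℤ) + 1))) / 2) / wo l)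
        - U2o k k')) :
    WeilPositivityOnChar χ a := by
  have hE0 : 0 < weilArchDensity (2 * a) := weilArchDensity_pos (by positivity)
  have hC : 0 ≤ a * (1 + weilArchDensity (2 * a)) := by positivity
  -- the sector kernels and far diagonals as functions
  set Mev : ℕ → ℕ → ℝ := fun i j ↦ (if i = 0 then twistedGramCoeffOdd χ a 0 j else if j = 0 then twistedGramCoeffOdd χ a i 0 else (twistedGramCoeffOdd χ a i j + twistedGramCoeffOdd χ a i (-(j : ℤ))) / 2) with hMev
  set Mod : ℕ → ℕ → ℝ := fun k l ↦ ((twistedGramCoeffOdd χ a ((k : ℤ) + 1) ((l : ℤ) + 1) - twistedGramCoeffOdd χ a ((k : ℤ) + 1) (-((l : ℤ) + 1))) / 2) with hMod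
  set dev : ℕ → ℝ := fun m ↦ ((reDigammaQuarter (freq a m) - Real.log π + Real.log q) / 2 - a * (1 + weilArchDensity (2 * a)) / (π ^ 2 * m ^ 2) - 1 / (8 * m) - a * (1 + weilArchDensity (2 * a)) / π ^ 2 * Real.sqrt (8 / ((Be - 1 : ℕ) : ℝ)) - (∑ k ∈ weilPrimeIndex a, (Λ k : ℝ) / Real.sqrt k * (2 * Real.cos (π / (⌊2 * a / Real.log k⌋₊ + 2)))) / 2) with hdev
  set dod : ℕ → ℝ := fun l ↦ ((reDigammaQuarter (freq a ((l : ℤ) + 1)) - Real.log π + Real.log q) / 2 - 1 / (8 * ((l : ℝ) + 1)) - a * (1 + weilArchDensity (2 * a)) / (π ^ 2 * ((l : ℝ) + 1) ^ 2) - (π / 2 - Real.arctan (Real.sqrt Bo / Real.sqrt ((l : ℝ) + 1))) / 2 - a * (1 + weilArchDensity (2 * a)) / π ^ 2 * Real.sqrt (8 / Bo) - (∑ k ∈ weilPrimeIndex a, (Λ k : ℝ) / Real.sqrt k * (2 * Real.cos (π / (⌊2 * a / Real.log k⌋₊ + 2)))) / 2) with hdod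
  have hsymm := twistedGramCoeffOdd_comm χ a
  have hrefl := twistedGramCoeffOdd_neg_neg χ a
  refine weilPositivityOnChar_of_twistedGramCoeffOdd_sector_psd hq χ hχ hodd ha ?_ ?_
  · -- EVEN sector
    intro K y
    have hBe1 : 1 ≤ Be := by omega
    have hd : ∀ m, Be ≤ m → 0 < dev m := fun m hm ↦ by
      simp only [hdev]
      have h := even_dhat_core_mono ha hC hBe1 hm
      linarith
    have hfar : ∀ (N : ℕ) (y : ℕ → ℝ),
        ∑ n ∈ Finset.Ico Be N, dev n * y n ^ 2 ≤ ∑ n ∈ Finset.Ico Be N, ∑ m ∈ Finset.Ico Be N, y n * Mev n m * y m :=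
      fun N y ↦ by
        simp only [hdev, hMev]
        exact twistedGramCoeffOdd_even_far_ge_diag χ ha hBe N y
    have hU1 : ∀ x : Fin Be → ℝ,
        ∑ m ∈ Finset.Ico Be B3e, (∑ i : Fin Be, Mev i m * x i) ^ 2 / dev m
          ≤ x ⬝ᵥ (Matrix.of fun i j : Fin Be ↦ ∑ m ∈ Finset.Ico Be B3e, Mev i m * Mev j m / we m) *ᵥ x :=
      fun x ↦ columns_majorant (Finset.Ico Be B3e) (fun m i ↦ Mev i m) dev we
        (fun m hm ↦ by
          have hm := Finset.mem_Ico.mp hm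
          have h := hwe m hm.1 hm.2
          simp only [hdev]
          exact h) x
    have key := sum_range_mul_mul_nonneg_of_certificate_sum_split Mev
      (fun n m ↦ evenKernel_symm (twistedGramCoeffOdd χ a) hsymm hrefl n m)
      Be B3e hBBe dev _ U2e hd hfar hU1 (fun N x ↦ by
        have h := hU2e N x
        simp only [hMev, hdev] at h ⊢
        exact h) (fun x ↦ by
        have h := hSe x
        simp only [hMev, Matrix.of_apply] at h ⊢
        exact h) (K + 1) y
    simpa only [hMev] using key
  · -- ODD sector
    intro K z
    have hd : ∀ l, Bo ≤ l → 0 < dod l := fun l hl ↦ by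
      simp only [hdod]
      have h := odd_dhat_core_mono ha hC hl
      have hpen := hilbert_atan_penalty_le Bo l
      linarith
    have hfar : ∀ (N : ℕ) (z : ℕ → ℝ),
        ∑ k ∈ Finset.Ico Bo N, dod k * z k ^ 2 ≤ ∑ k ∈ Finset.Ico Bo N, ∑ l ∈ Finset.Ico Bo N, z k * Mod k l * z l :=
      fun N z ↦ by
        simp only [hdod, hMod]
        exact twistedGramCoeffOdd_odd_far_ge_diag_atan χ ha hBo N z
    have hU1 : ∀ x : Fin Bo → ℝ,
        ∑ l ∈ Finset.Ico Bo B3o, (∑ k : Fin Bo, Mod k l * x k) ^ 2 / dod l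
          ≤ x ⬝ᵥ (Matrix.of fun k k' : Fin Bo ↦ ∑ l ∈ Finset.Ico Bo B3o, Mod k l * Mod k' l / wo l) *ᵥ x :=
      fun x ↦ columns_majorant (Finset.Ico Bo B3o) (fun l k ↦ Mod k l) dod wo
        (fun l hl ↦ by
          have hl := Finset.mem_Ico.mp hl
          have h := hwo l hl.1 hl.2
          simp only [hdod]
          exact h) x
    have key := sum_range_mul_mul_nonneg_of_certificate_sum_split Mod
      (fun k l ↦ oddKernel_symm (twistedGramCoeffOdd χ a) hsymm hrefl k l)
      Bo B3o hBBo dod _ U2o hd hfar hU1 (fun N x ↦ by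
        have h := hU2o N x
        simp only [hMod, hdod] at h ⊢
        exact h) (fun x ↦ by
        have h := hSo x
        simp only [hMod, Matrix.of_apply] at h ⊢
        exact h) K z
    simpa only [hMod] using key

end Rung

end Summit.Ventures.WeilGRH

end
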